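import Summits.QuantumFields.BalabanUV.Beta.GAN24.BorderedFrameInverseDecomp

/-!
# `BalabanUV.Beta.GAN24.BorderedFrameInverseExact` — binder row G-an2-4 / (CONV-C), road P1-fibre, typer row **P1-E1** (DAG node N10c) in the form asked for by
# `GAN24/Formal/LEAVES.md` v2.2 (3) (leaf-05-g6's STRUCTURE NOTE, form (ii)): the EXACT inverse of a RANK-ONE-BORDERED matrix `K = [[P, a·u], [b·uᴴ, 0]]`
# for a GENERAL block `P`, with all-parameter-uniform block bounds — no Neumann step, no smallness, no annulus

NOT IN PRINT; OUR PROOF ATTEMPT (of the road; THIS file is [folklore] finite-dimensional linear algebra, Mathlib + parts 1–3 only).  HONEST FRAMING (cell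
contract, verbatim): «discharging `BetaPertH` makes Bałaban's UV stability UNCONDITIONAL — a real constructive-QFT result; it is NOT the continuum limit
and NOT the Clay problem.»  HONEST DEPENDENCY (verbatim): «continuum YM on T⁴ ⇐ BetaPertH ∧ nine spine estimates (0/9 proved); BetaPertH ⇐ (D1) ∧ (D4) ∧
CAP+tail; G-an2-4 gates asym, D1 and NE2/3/4.»  No cited fact, no wall binder, no `def … : Prop` hypothesis; an OPTIONAL engine for node N13 (beside the
scalar closed form Y08f/Y08s): it needs only the transverse coercivity of `P` on `u⊥` (L08a-type input), not the diagonal structure of `𝒫`.  Discharges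
NOTHING of the K-slot of (CONV-C); NOT summit progress.

## What is proved
For `P : Matrix ι ι ℂ` (arbitrary), a unit vector `u` (`uᴴu = 1`), scalars `a b`, let `K = bordered P u a b := fromBlocks P (col (a•u)) (row (b•uᴴ)) 0`,
`Π = projPerp u = 1 − uuᴴ`, `Q = qT P u := pinvT (Π P Π) u` (parts 1, 3: the inverse of `ΠPΠ` on `u⊥`, extended by `0`).  If `P` is `τ`-coercive on `u⊥`
(`τ·Σ‖x i‖² ≤ Re(xᴴPx)` for `uᴴx = 0`, `τ > 0`) and `a b ≠ 0`:
* `bordered_mul_borderedInv`, `isUnit_bordered`, **`inv_bordered`**: `K⁻¹ = borderedInv P u a b = [[Q, b⁻¹(u − Q P u)], [a⁻¹(uᴴ − uᴴ P Q), (uᴴPQPu − uᴴPu)/(ab)]]`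
  EXACTLY; in particular `(K⁻¹)_{φφ} = Q` has ZERO `u`-row and `u`-column (`qT_mulVec_u`, `u_vecMul_qT`);
* the UNIFORM BLOCK BOUNDS (every constant a function of `τ, ‖P‖, |a|, |b|` only): **`norm_qT_le`** `‖(K⁻¹)_{φφ}‖ ≤ 1/τ`, **`norm_inv_bordered_col_le`**
  `‖(K⁻¹)_{φc}‖₂ ≤ (1 + ‖P‖/τ)/|b|`, **`norm_inv_bordered_row_le`** `‖(K⁻¹)_{cφ}‖₂ ≤ (1 + ‖P‖/τ)/|a|`, **`norm_inv_bordered_cc_le`**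
  `|(K⁻¹)_{cc}| ≤ ‖P‖(1 + ‖P‖/τ)/(|a||b|)`.
Algebra used: `Π P Q = Π` (`projPerp_mul_mul_qT`), `uᴴQ = 0`, `Qu = 0`, whence the pole-free identity `Pu − PQPu = (uᴴPu − uᴴPQPu)·u` (`key_vec`).
-/

open Matrix WithLp Complex
open scoped ComplexConjugate Matrix.Norms.L2Operator InnerProductSpace

namespace Summit.QuantumFields.BalabanUV.Beta.GAN24.BorderedFrameInverseExact

open Summit.QuantumFields.BalabanUV.Beta.GAN24.BorderedFrameInverse
open Summit.QuantumFields.BalabanUV.Beta.GAN24.BorderedFrameInverseBlocks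
open Summit.QuantumFields.BalabanUV.Beta.GAN24.BorderedFrameInverseDecomp

variable {ι : Type*} [Fintype ι]

/-- [folklore] The RANK-ONE-BORDERED matrix `K = [[P, a·u], [b·uᴴ, 0]]` on `ι ⊕ Unit`. -/
def bordered (P : Matrix ι ι ℂ) (u : ι → ℂ) (a b : ℂ) : Matrix (ι ⊕ Unit) (ι ⊕ Unit) ℂ :=
  fromBlocks P (replicateCol Unit (a • u)) (replicateRow Unit (b • star u)) 0

variable [DecidableEq ι]

/-- [folklore] The TRANSVERSE SOLVE `Q = (Π P Π)⁺`: the inverse of `Π P Π` on `u⊥`, extended by `0` on `span u`. -/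
noncomputable def qT (P : Matrix ι ι ℂ) (u : ι → ℂ) : Matrix ι ι ℂ := pinvT (compT P u) u

/-- [folklore] The EXPLICIT INVERSE `[[Q, b⁻¹(u − QPu)], [a⁻¹(uᴴ − uᴴPQ), (uᴴPQPu − uᴴPu)/(ab)]]` of the rank-one-bordered matrix. -/
noncomputable def borderedInv (P : Matrix ι ι ℂ) (u : ι → ℂ) (a b : ℂ) : Matrix (ι ⊕ Unit) (ι ⊕ Unit) ℂ :=
  fromBlocks (qT P u) (replicateCol Unit (b⁻¹ • (u - qT P u *ᵥ (P *ᵥ u))))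
    (replicateRow Unit (a⁻¹ • (star u - star u ᵥ* (P * qT P u))))
    (of fun _ _ => (star u ⬝ᵥ ((P * qT P u * P) *ᵥ u) - star u ⬝ᵥ (P *ᵥ u)) / (a * b))

variable {P : Matrix ι ι ℂ} {u : ι → ℂ} {τ : ℝ} {a b : ℂ}

/-- [folklore] `Π P Π + uuᴴ` is invertible when `P` is `τ`-coercive on `u⊥` (`τ > 0`). -/
theorem isUnit_compT_aug (hu : star u ⬝ᵥ u = 1) (hτ : 0 < τ)
    (hco : ∀ x : ι → ℂ, star u ⬝ᵥ x = 0 → τ * (∑ i, ‖x i‖ ^ 2) ≤ (star x ⬝ᵥ (P *ᵥ x)).re) :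
    IsUnit (compT P u + uuH u) :=
  isUnit_aug hu (u_vecMul_compT hu P) (inj_of_coercive hτ (compT_coercive hco))

/-- [folklore] `Q u = 0`: the `u`-column of `(K⁻¹)_{φφ}` vanishes. -/
theorem qT_mulVec_u (hu : star u ⬝ᵥ u = 1) (hA : IsUnit (compT P u + uuH u)) : qT P u *ᵥ u = 0 :=
  pinvT_mulVec_u hu (compT_mulVec_u hu P) hA

/-- [folklore] `uᴴ Q = 0`: the `u`-row of `(K⁻¹)_{φφ}` vanishes. -/
theorem u_vecMul_qT (hu : star u ⬝ᵥ u = 1) (hA : IsUnit (compT P u + uuH u)) : star u ᵥ* qT P u = 0 :=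
  u_vecMul_pinvT hu (u_vecMul_compT hu P) hA

/-- [folklore] `Π Q = Q`. -/
theorem projPerp_mul_qT (hu : star u ⬝ᵥ u = 1) (hA : IsUnit (compT P u + uuH u)) : projPerp u * qT P u = qT P u := by
  rw [projPerp, sub_mul, one_mul, uuH_mul, u_vecMul_qT hu hA, vecMulVec_zero, sub_zero]

/-- [folklore] `Π P Q = Π` (the transverse resolvent identity). -/
theorem projPerp_mul_mul_qT (hu : star u ⬝ᵥ u = 1) (hA : IsUnit (compT P u + uuH u)) :
    projPerp u * P * qT P u = projPerp u := by
  have h : compT P u * qT P u = 1 - uuH u := mul_pinvT hu (compT_mulVec_u hu P) (u_vecMul_compT hu P) hA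
  rw [compT, Matrix.mul_assoc, projPerp_mul_qT hu hA] at h
  rw [h, projPerp]

/-- [folklore] The pole-free identity `P u − P Q P u = (uᴴPu − uᴴPQPu) · u`. -/
theorem key_vec (hu : star u ⬝ᵥ u = 1) (hA : IsUnit (compT P u + uuH u)) :
    P *ᵥ u - (P * qT P u * P) *ᵥ u = (star u ⬝ᵥ (P *ᵥ u) - star u ⬝ᵥ ((P * qT P u * P) *ᵥ u)) • u := by
  have h1 : projPerp u *ᵥ ((P * qT P u * P) *ᵥ u) = projPerp u *ᵥ (P *ᵥ u) := by
    simp only [mulVec_mulVec, ← Matrix.mul_assoc, projPerp_mul_mul_qT hu hA]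
  rw [projPerp, sub_mulVec, sub_mulVec, one_mulVec, one_mulVec, uuH_mulVec, uuH_mulVec] at h1
  -- h1 : PQPu − (uᴴPQPu)•u = Pu − (uᴴPu)•u
  rw [sub_smul, ← neg_sub, sub_eq_sub_iff_sub_eq_sub.mp h1, neg_sub]

omit [Fintype ι] [DecidableEq ι] in
/-- [folklore] `col v · (c) = col (c • v)` for a `Unit`-bordered column. -/
theorem replicateCol_mul_of (v : ι → ℂ) (c : ℂ) :
    replicateCol Unit v * (of fun _ _ => c : Matrix Unit Unit ℂ) = replicateCol Unit (c • v) := by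
  ext i j; simp [Matrix.mul_apply, replicateCol_apply, mul_comm]

/-- [folklore] **THE BORDERED MATRIX TIMES ITS EXPLICIT INVERSE IS THE IDENTITY** (`a b ≠ 0`, `ΠPΠ` injective on `u⊥`). -/
theorem bordered_mul_borderedInv (hu : star u ⬝ᵥ u = 1) (hA : IsUnit (compT P u + uuH u)) (ha : a ≠ 0) (hb : b ≠ 0) :
    bordered P u a b * borderedInv P u a b = 1 := by
  rw [bordered, borderedInv, fromBlocks_multiply, ← fromBlocks_one]
  have hPiPQ := projPerp_mul_mul_qT hu hA
  have e1 : P * qT P u + replicateCol Unit (a • u) * replicateRow Unit (a⁻¹ • (star u - star u ᵥ* (P * qT P u))) = 1 := by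
    rw [← vecMulVec_eq Unit, smul_vecMulVec, vecMulVec_smul, smul_smul, mul_inv_cancel₀ ha, one_smul, vecMulVec_sub,
      ← uuH, ← uuH_mul]
    rw [projPerp, sub_mul, sub_mul, one_mul, Matrix.mul_assoc] at hPiPQ
    -- hPiPQ : P Q − uuH (P Q) = 1 − uuH
    rw [← sub_eq_zero] at hPiPQ ⊢
    rw [← hPiPQ]; abel
  have e2 : P * replicateCol Unit (b⁻¹ • (u - qT P u *ᵥ (P *ᵥ u))) +
      replicateCol Unit (a • u) * (of fun _ _ => (star u ⬝ᵥ ((P * qT P u * P) *ᵥ u) - star u ⬝ᵥ (P *ᵥ u)) / (a * b)) = 0 := by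
    rw [← replicateCol_mulVec, replicateCol_mul_of, ← replicateCol_add, mulVec_smul, mulVec_sub, mulVec_mulVec,
      mulVec_mulVec, key_vec hu hA, smul_smul, smul_smul, ← add_smul]
    rw [show b⁻¹ * (star u ⬝ᵥ P *ᵥ u - star u ⬝ᵥ (P * qT P u * P) *ᵥ u) +
        (star u ⬝ᵥ (P * qT P u * P) *ᵥ u - star u ⬝ᵥ P *ᵥ u) / (a * b) * a = 0 by field_simp; ring]
    rw [zero_smul, replicateCol_zero]
  have e3 : replicateRow Unit (b • star u) * qT P u +
      (0 : Matrix Unit Unit ℂ) * replicateRow Unit (a⁻¹ • (star u - star u ᵥ* (P * qT P u))) = 0 := by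
    rw [Matrix.zero_mul, add_zero, ← replicateRow_vecMul, smul_vecMul, u_vecMul_qT hu hA, smul_zero, replicateRow_zero]
  have e4 : replicateRow Unit (b • star u) * replicateCol Unit (b⁻¹ • (u - qT P u *ᵥ (P *ᵥ u))) +
      (0 : Matrix Unit Unit ℂ) * (of fun _ _ => (star u ⬝ᵥ ((P * qT P u * P) *ᵥ u) - star u ⬝ᵥ (P *ᵥ u)) / (a * b)) = 1 := by
    rw [Matrix.zero_mul, add_zero]
    ext i j
    rw [replicateRow_mul_replicateCol_apply, smul_dotProduct, dotProduct_smul, dotProduct_sub, hu, dotProduct_mulVec,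
      u_vecMul_qT hu hA, zero_dotProduct, sub_zero, smul_eq_mul, smul_eq_mul, mul_one, mul_inv_cancel₀ hb, Matrix.one_apply,
      if_pos (Subsingleton.elim i j)]
  rw [e1, e2, e3, e4]

/-- [folklore] The rank-one-bordered matrix is invertible (`a b ≠ 0`, `P` `τ`-coercive on `u⊥`). -/
theorem isUnit_bordered (hu : star u ⬝ᵥ u = 1) (hA : IsUnit (compT P u + uuH u)) (ha : a ≠ 0) (hb : b ≠ 0) :
    IsUnit (bordered P u a b) :=
  (isUnit_iff_isUnit_det _).2 (isUnit_det_of_right_inverse (bordered_mul_borderedInv hu hA ha hb))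

/-- [folklore] **`K⁻¹ = borderedInv` EXACTLY.** -/
theorem inv_bordered (hu : star u ⬝ᵥ u = 1) (hA : IsUnit (compT P u + uuH u)) (ha : a ≠ 0) (hb : b ≠ 0) :
    (bordered P u a b)⁻¹ = borderedInv P u a b :=
  inv_eq_right_inv (bordered_mul_borderedInv hu hA ha hb)

/-! ### The uniform block bounds -/

/-- [folklore] `(K⁻¹)_{φφ} = Q`, `(K⁻¹)_{φc} = b⁻¹(u − QPu)`, `(K⁻¹)_{cφ} = a⁻¹(uᴴ − uᴴPQ)`, `(K⁻¹)_{cc} = (uᴴPQPu − uᴴPu)/(ab)` (read off `borderedInv`). -/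
theorem borderedInv_blocks (P : Matrix ι ι ℂ) (u : ι → ℂ) (a b : ℂ) :
    (borderedInv P u a b).toBlocks₁₁ = qT P u ∧
    (fun i => borderedInv P u a b (Sum.inl i) (Sum.inr ())) = b⁻¹ • (u - qT P u *ᵥ (P *ᵥ u)) ∧
    (fun i => borderedInv P u a b (Sum.inr ()) (Sum.inl i)) = a⁻¹ • (star u - star u ᵥ* (P * qT P u)) ∧
    borderedInv P u a b (Sum.inr ()) (Sum.inr ()) = (star u ⬝ᵥ ((P * qT P u * P) *ᵥ u) - star u ⬝ᵥ (P *ᵥ u)) / (a * b) := by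
  refine ⟨by rw [borderedInv, toBlocks_fromBlocks₁₁], ?_, ?_, by simp [borderedInv]⟩
  · ext i; simp [borderedInv, replicateCol_apply]
  · ext i; simp [borderedInv, replicateRow_apply]

/-- [folklore] **`‖(K⁻¹)_{φφ}‖ = ‖Q‖ ≤ 1/τ`.** -/
theorem norm_qT_le (hu : star u ⬝ᵥ u = 1) (hτ : 0 < τ)
    (hco : ∀ x : ι → ℂ, star u ⬝ᵥ x = 0 → τ * (∑ i, ‖x i‖ ^ 2) ≤ (star x ⬝ᵥ (P *ᵥ x)).re) : ‖qT P u‖ ≤ 1 / τ :=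
  norm_pinvT_le hu (compT_mulVec_u hu P) (u_vecMul_compT hu P) hτ (compT_coercive hco)

/-- [folklore] `(K⁻¹)_{φφ} = Q` — with ZERO `u`-row and `u`-column (`qT_mulVec_u`, `u_vecMul_qT`). -/
theorem inv_bordered_toBlocks₁₁ (hu : star u ⬝ᵥ u = 1) (hA : IsUnit (compT P u + uuH u)) (ha : a ≠ 0) (hb : b ≠ 0) :
    ((bordered P u a b)⁻¹).toBlocks₁₁ = qT P u := by
  rw [inv_bordered hu hA ha hb, (borderedInv_blocks P u a b).1]

/-- [folklore] **`‖(K⁻¹)_{φφ}‖ ≤ 1/τ`.** -/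
theorem norm_inv_bordered_toBlocks₁₁_le (hu : star u ⬝ᵥ u = 1) (hτ : 0 < τ)
    (hco : ∀ x : ι → ℂ, star u ⬝ᵥ x = 0 → τ * (∑ i, ‖x i‖ ^ 2) ≤ (star x ⬝ᵥ (P *ᵥ x)).re) (ha : a ≠ 0) (hb : b ≠ 0) :
    ‖((bordered P u a b)⁻¹).toBlocks₁₁‖ ≤ 1 / τ := by
  rw [inv_bordered_toBlocks₁₁ hu (isUnit_compT_aug hu hτ hco) ha hb]
  exact norm_qT_le hu hτ hco

/-- [folklore] `‖Q P u‖₂ ≤ ‖P‖/τ`. -/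
theorem norm_qT_P_u_le (hu : star u ⬝ᵥ u = 1) (hτ : 0 < τ)
    (hco : ∀ x : ι → ℂ, star u ⬝ᵥ x = 0 → τ * (∑ i, ‖x i‖ ^ 2) ≤ (star x ⬝ᵥ (P *ᵥ x)).re) :
    ‖(toLp 2 (qT P u *ᵥ (P *ᵥ u)) : EuclideanSpace ℂ ι)‖ ≤ ‖P‖ / τ := by
  have h1 := Matrix.l2_opNorm_mulVec (qT P u) (toLp 2 (P *ᵥ u) : EuclideanSpace ℂ ι)
  have h2 := Matrix.l2_opNorm_mulVec P (toLp 2 u : EuclideanSpace ℂ ι)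
  rw [ofLp_toLp, norm_toLp_of_unit hu, mul_one] at h2
  rw [ofLp_toLp] at h1
  calc ‖(toLp 2 (qT P u *ᵥ (P *ᵥ u)) : EuclideanSpace ℂ ι)‖ ≤ ‖qT P u‖ * ‖(toLp 2 (P *ᵥ u) : EuclideanSpace ℂ ι)‖ := h1
    _ ≤ (1 / τ) * ‖P‖ := by
        gcongr
        · exact norm_qT_le hu hτ hco
        · exact h2
    _ = ‖P‖ / τ := by ring

/-- [folklore] **`‖(K⁻¹)_{φc}‖₂ ≤ (1 + ‖P‖/τ)/|b|`.** -/
theorem norm_inv_bordered_col_le (hu : star u ⬝ᵥ u = 1) (hτ : 0 < τ)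
    (hco : ∀ x : ι → ℂ, star u ⬝ᵥ x = 0 → τ * (∑ i, ‖x i‖ ^ 2) ≤ (star x ⬝ᵥ (P *ᵥ x)).re) (ha : a ≠ 0) (hb : b ≠ 0) :
    ‖(toLp 2 (fun i => (bordered P u a b)⁻¹ (Sum.inl i) (Sum.inr ())) : EuclideanSpace ℂ ι)‖ ≤ (1 + ‖P‖ / τ) / ‖b‖ := by
  rw [inv_bordered hu (isUnit_compT_aug hu hτ hco) ha hb, (borderedInv_blocks P u a b).2.1, toLp_smul, norm_smul, norm_inv,
    toLp_sub, div_eq_inv_mul]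
  gcongr
  refine (norm_sub_le _ _).trans ?_
  rw [norm_toLp_of_unit hu]
  gcongr
  exact norm_qT_P_u_le hu hτ hco

/-- [folklore] **`‖(K⁻¹)_{cφ}‖₂ ≤ (1 + ‖P‖/τ)/|a|`.** -/
theorem norm_inv_bordered_row_le (hu : star u ⬝ᵥ u = 1) (hτ : 0 < τ)
    (hco : ∀ x : ι → ℂ, star u ⬝ᵥ x = 0 → τ * (∑ i, ‖x i‖ ^ 2) ≤ (star x ⬝ᵥ (P *ᵥ x)).re) (ha : a ≠ 0) (hb : b ≠ 0) :
    ‖(toLp 2 (fun i => (bordered P u a b)⁻¹ (Sum.inr ()) (Sum.inl i)) : EuclideanSpace ℂ ι)‖ ≤ (1 + ‖P‖ / τ) / ‖a‖ := by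
  rw [inv_bordered hu (isUnit_compT_aug hu hτ hco) ha hb, (borderedInv_blocks P u a b).2.2.1, toLp_smul, norm_smul, norm_inv,
    toLp_sub, div_eq_inv_mul]
  gcongr
  refine (norm_sub_le _ _).trans ?_
  rw [norm_toLp_star, norm_toLp_of_unit hu]
  gcongr
  -- ‖uᴴ (P Q)‖₂ = ‖(PQ)ᴴ u‖₂ ≤ ‖PQ‖ ≤ ‖P‖/τ
  have h1 : star u ᵥ* (P * qT P u) = star ((P * qT P u)ᴴ *ᵥ u) := by
    rw [star_mulVec, conjTranspose_conjTranspose]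
  rw [h1, norm_toLp_star]
  have h2 := Matrix.l2_opNorm_mulVec (P * qT P u)ᴴ (toLp 2 u : EuclideanSpace ℂ ι)
  rw [ofLp_toLp, norm_toLp_of_unit hu, mul_one, Matrix.l2_opNorm_conjTranspose] at h2
  refine h2.trans ((Matrix.l2_opNorm_mul _ _).trans ?_)
  calc ‖P‖ * ‖qT P u‖ ≤ ‖P‖ * (1 / τ) := by gcongr; exact norm_qT_le hu hτ hco
    _ = ‖P‖ / τ := by ring

/-- [folklore] **`|(K⁻¹)_{cc}| ≤ ‖P‖(1 + ‖P‖/τ)/(|a||b|)`.** -/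
theorem norm_inv_bordered_cc_le (hu : star u ⬝ᵥ u = 1) (hτ : 0 < τ)
    (hco : ∀ x : ι → ℂ, star u ⬝ᵥ x = 0 → τ * (∑ i, ‖x i‖ ^ 2) ≤ (star x ⬝ᵥ (P *ᵥ x)).re) (ha : a ≠ 0) (hb : b ≠ 0) :
    ‖(bordered P u a b)⁻¹ (Sum.inr ()) (Sum.inr ())‖ ≤ ‖P‖ * (1 + ‖P‖ / τ) / (‖a‖ * ‖b‖) := by
  rw [inv_bordered hu (isUnit_compT_aug hu hτ hco) ha hb, (borderedInv_blocks P u a b).2.2.2, norm_div, norm_mul]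
  gcongr
  refine (norm_sub_le _ _).trans ?_
  have h1 := norm_dotProduct_mulVec_le (P * qT P u * P) (toLp 2 u : EuclideanSpace ℂ ι) (toLp 2 u)
  have h2 := norm_dotProduct_mulVec_le P (toLp 2 u : EuclideanSpace ℂ ι) (toLp 2 u)
  rw [ofLp_toLp, norm_toLp_of_unit hu, one_mul, mul_one] at h1 h2
  have h3 : ‖P * qT P u * P‖ ≤ ‖P‖ * (1 / τ) * ‖P‖ :=
    (Matrix.l2_opNorm_mul _ _).trans (by gcongr; exact (Matrix.l2_opNorm_mul _ _).trans (by gcongr; exact norm_qT_le hu hτ hco))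
  calc ‖star u ⬝ᵥ (P * qT P u * P) *ᵥ u‖ + ‖star u ⬝ᵥ P *ᵥ u‖ ≤ ‖P‖ * (1 / τ) * ‖P‖ + ‖P‖ := add_le_add (h1.trans h3) h2
    _ = ‖P‖ * (1 + ‖P‖ / τ) := by ring

end Summit.QuantumFields.BalabanUV.Beta.GAN24.BorderedFrameInverseExact
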